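import Literature.Topology.FourManifolds.LatticeFormsStableOrthogonalGroupSublattice
import HarnessLib

/-!
# The glue projection `p_{S^⊥}(H) ⊂ D(S^⊥)`: `|p_{S^⊥}(H)| = [L : S ⊕ S^⊥]`, and `O(L, S)|_{S^⊥} = Õ(S^⊥)` when
# `p_{S^⊥}(H) = D(S^⊥)` (Gritsenko–Hulek–Sankaran, *Compositio Math.* 146 (2010) Lemma 4.2 (iii)–(iv), Cor. 4.4;
# *Handbook of Moduli* (2013) Lemma 7.3 (iii)–(iv), Cor. 7.4)

Trunk T-4MAN vocabulary; sequel of `LatticeFormsStableOrthogonalGroupSublattice.lean` (row g42-#1: restriction ∕ extension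
of isometries across `S ⊕ S^⊥ ⊂ L`, Lemma 4.2 (i)–(ii), Lemma 7.1). Here `p_T(H)` is the range of the tree's
`B.toDiscriminantGroup T : L → D(T)`, `x ↦ [(x, ·)|_T]` (`LatticeFormsOverlattices.lean`), `D(T) = T^*/T`
(`discriminantGroup`), `q_T = discriminantQuad`, `ḡ = IsometryEquiv.discriminantGroupCongr g`. Written for lane
`lit-hodgefound` (Track 2 foundations; prover seat `lit-hodgefound-p18`, gen 42, row g42-#3). THEOREMS ONLY — no
definition, no named fact, no instance, no notation.

## Source, verbatim (V. Gritsenko, K. Hulek, G. K. Sankaran, Compositio Math. 146 (2010), arXiv numbering §4, held text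
`paper:arxiv-0802.2078` p. 10; = Handbook of Moduli (2013) §7 Lemma 7.3, Cor. 7.4, held text `paper:arxiv-1012.4155` p. 28)

"The overlattice `L` is defined by the finite subgroup `H = L/(S^⊥ ⊕ S) < (S^⊥)^∨/S^⊥ ⊕ S^∨/S = D(S^⊥) ⊕ D(S)` […]
we consider the projections `p_S : H → D(S)`, `p_{S^⊥} : H → D(S^⊥)`. Using the definitions and the fact that the
lattices `S` and `S^⊥` are primitive in `L` one can show (see [Nik]) that these projections are injective […]
**Lemma 4.2.** Let `S` be a primitive sublattice of an even lattice `L`. (i) `g ∈ O(L,S)` if and only if `g(S) = S`,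
`ḡ|_{D(S)} = id` and `ḡ|_{p_{S^⊥}(H)} = id`. (ii) `α ∈ O(S^⊥)` can be extended to `O(L,S)` if and only if
`ᾱ|_{p_{S^⊥}(H)} = id`. (iii) If `p_{S^⊥}(H) = D(S^⊥)` then `O(L,S)|_{S^⊥} ≅ Õ(S^⊥)`. (iv) Assume that the projection
`O(S^⊥) → O(D(S^⊥))` is surjective. Then `O(L,S)|_{S^⊥}/Õ(S^⊥) ≅ {γ̄ ∈ O(D(S^⊥)) | γ̄|_{p_{S^⊥}(H)} = id}`. […]
**Corollary 4.4.** If `|H| = |det S^⊥|` then `O(L,S)|_{S^⊥} ≅ Õ(S^⊥)`. *Proof.* This follows from the injectivity of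
`p_{S^⊥}` on `H` and from Lemma 4.2 (iii). For example, the condition of the corollary is true if `L` is an even
unimodular lattice and `S` is any primitive sublattice of `L`." (Handbook: "Since `L/(S ⊕ S^⊥) ≅ φ(L)/S` we obtain
`|L/(S ⊕ S^⊥)| = |φ(L)/S|`", `φ(l)(s) = (l, s)`, `ker φ = S^⊥`.)

## Contents (all proved; `B` symmetric on a finitely generated free `ℤ`-module `M = L` where finiteness is used)

* §1 **`p_T` is injective on `H`**: `ker (L → D(T)) = T ⊔ T^⊥` (`ker_toDiscriminantGroup_eq_sup_orthogonal`, the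
  tree's `ker_mkQ_comp_domRestrict₂`) and **`|p_T(H)| = [L : T ⊕ T^⊥]`** (`natCard_range_toDiscriminantGroup_eq_index`);
  `[L : T ⊕ T^⊥] = |D(T)| ⟹ p_T(H) = D(T)` (`range_toDiscriminantGroup_eq_top_of_index_eq_natCard`); for a primitive `S`
  with `B|_S`, `B|_{S^⊥}` nondegenerate, `(S^⊥)^⊥ = S` (`orthogonal_orthogonal_eq_of_forall_smul_mem_of_nondegenerate`), so
  `T ⊔ T^⊥ = S ⊕ S^⊥` for `T = S^⊥` and `|p_{S^⊥}(H)| = [L : S ⊕ S^⊥] = |H|`.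
* §2 **Lemma 4.2 (iii)**: if `p_{S^⊥}(H) = D(S^⊥)` then the restrictions to `S^⊥` of the isometries of `L` trivial on `S`
  — and equally of those with `G|_S ∈ Õ(S)`, the printed `O(L,S)` — are exactly `Õ(S^⊥)`
  (`setOf_exists_forall_apply_eq_eq_setOf_discriminantGroupCongr_eq_id_of_range_eq_top`,
  `setOf_exists_restrict_stable_eq_setOf_discriminantGroupCongr_eq_id_of_range_eq_top`); **Cor. 4.4** in the printed
  index form (`…_of_index_eq_natCard`); and its **unimodular example for every sublattice `S` with `B|_S`
  nondegenerate** (`setOf_discriminantGroupCongr_eq_id_eq_setOf_exists_forall_apply_eq_of_isPerfPair`: Huybrechts'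
  Cor. 14.2.7 `{g ∈ O(S^⊥) | ḡ = id} = {g|_{S^⊥} | g ∈ O(Λ), g|_S = id}`, in the tree so far only for `S = ℤℓ` as
  `setOf_discriminantGroupCongr_eq_id_eq`).
* §3 **Lemma 4.2 (iv)** as a counting statement: if every `q`-isometry of `D(T)` lifts to `O(T)` (`T` even), the classes
  of `{γ ∈ O(T) | γ̄|_{p_T(H)} = id}` modulo "same `γ̄`" (= the cosets of `Õ(T)`) are equinumerous with
  `{σ ∈ O(q_T) | σ|_{p_T(H)} = id}` (`natCard_quot_setOf_discriminantGroupCongr_toDiscriminantGroup_eq`); by Lemma 4.2 (ii)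
  (`exists_isometryEquiv_eq_id_extends_iff`) the former set is `O(L, S)|_{S^⊥}` for `T = S^⊥`.
* GROUPS ∕ PARITY. As in the sibling files: no `O⁺`; `Õ = {g | ḡ = id}`; "`≅`" of groups is rendered as equality of
  subsets of `O(S^⊥)` (restriction being injective by `isometryEquiv_apply_eq_of_eqOn_of_eqOn_orthogonal`). Evenness
  is used only in §3, where `q_T` is needed to say "`O(D(S^⊥))`" = `O(q_{S^⊥})`.

## References

* [GritsenkoHulekSankaran2010Symplectic] V. Gritsenko, K. Hulek, G. K. Sankaran, Moduli spaces of irreducible symplectic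
  manifolds, Compositio Math. 146 (2010) 404–434 (arXiv:0802.2078): §4 Lemma 4.2 (iii)–(iv), Cor. 4.4.
* [GritsenkoHulekSankaran2013ModuliK3] V. Gritsenko, K. Hulek, G. K. Sankaran, Moduli of K3 surfaces and irreducible
  symplectic manifolds, Handbook of Moduli I (2013): §7 Lemma 7.2 (proof), Lemma 7.3 (iii)–(iv), Cor. 7.4, Example 7.6.
* [Nikulin1980] V. V. Nikulin, Integral symmetric bilinear forms and some of their geometric applications, Math. USSR
  Izv. 14 (1980): §1.5 (Prop. 1.5.1, Cor. 1.5.2).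
* [Huybrechts2016K3] D. Huybrechts, Lectures on K3 Surfaces, CUP 2016, Ch. 14 §0.2, Cor. 2.7.
-/

noncomputable section

open Module Function
open LinearMap (BilinForm)
open Literature.Topology.FourManifolds

namespace LinearMap.BilinForm

/-! ### §1 `p_T(H)`: kernel `T ⊔ T^⊥`, order `[L : T ⊕ T^⊥]` -/

section Projection

variable {M : Type*} [AddCommGroup M] (B : BilinForm ℤ M) (T : Submodule ℤ M)

/-- **`ker (L → D(T)) = T ⊕ T^⊥`** ("`p_{S^⊥}` is injective on `H = L/(S ⊕ S^⊥)`"): `[(x, ·)|_T] = 0` iff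
`(x, ·)|_T = (t, ·)|_T` for some `t ∈ T` iff `x − t ∈ T^⊥`. [cite: GritsenkoHulekSankaran2010Symplectic, §4 before Lemma 4.1 ("these projections are injective")] [cite: GritsenkoHulekSankaran2013ModuliK3, §7 proof of Lemma 7.2 ("`ker(φ) = S^⊥`")] -/
theorem ker_toDiscriminantGroup_eq_sup_orthogonal (hB : B.IsSymm) :
    LinearMap.ker (B.toDiscriminantGroup T) = T ⊔ B.orthogonal T :=
  B.ker_mkQ_comp_domRestrict₂ T hB

/-- **`|p_T(H)| = [L : T ⊕ T^⊥]`**: the range of `L → D(T)` is in bijection with `L/(T ⊕ T^⊥)` ("Since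
`L/(S ⊕ S^⊥) ≅ φ(L)/S` we obtain `|L/(S ⊕ S^⊥)| = |φ(L)/S|`"). [cite: GritsenkoHulekSankaran2013ModuliK3, §7 proof of Lemma 7.2] [cite: GritsenkoHulekSankaran2010Symplectic, §4 proof of Cor. 4.4 ("the injectivity of `p_{S^⊥}` on `H`")] -/
theorem natCard_range_toDiscriminantGroup_eq_index (hB : B.IsSymm) :
    Nat.card (LinearMap.range (B.toDiscriminantGroup T)) = (T ⊔ B.orthogonal T).toAddSubgroup.index := by
  rw [← B.ker_toDiscriminantGroup_eq_sup_orthogonal T hB, AddSubgroup.index_eq_card]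
  exact (Nat.card_congr (B.toDiscriminantGroup T).quotKerEquivRange.toEquiv).symm

variable [Module.Finite ℤ M] [Module.Free ℤ M]

/-- **`[L : T ⊕ T^⊥] = |D(T)| ⟹ p_T(H) = D(T)`** (`B|_T` nondegenerate, so that `D(T)` is finite): a subgroup of
full order is everything — the counting step of Cor. 4.4. [cite: GritsenkoHulekSankaran2010Symplectic, §4 Cor. 4.4 (proof)] -/
theorem range_toDiscriminantGroup_eq_top_of_index_eq_natCard (hB : B.IsSymm) (hT : (B.restrict T).Nondegenerate)
    (h : (T ⊔ B.orthogonal T).toAddSubgroup.index = Nat.card (B.restrict T).discriminantGroup) :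
    LinearMap.range (B.toDiscriminantGroup T) = ⊤ := by
  haveI : Finite (B.restrict T).discriminantGroup := finite_discriminantGroup _ hT
  have hcard : Nat.card (LinearMap.range (B.toDiscriminantGroup T)).toAddSubgroup =
      Nat.card (B.restrict T).discriminantGroup := by
    rw [← h, ← B.natCard_range_toDiscriminantGroup_eq_index T hB]
    rfl
  have htop := AddSubgroup.eq_top_of_card_eq _ hcard
  refine eq_top_iff.2 fun a _ ↦ ?_
  have ha : a ∈ (LinearMap.range (B.toDiscriminantGroup T)).toAddSubgroup := by
    rw [htop]
    exact AddSubgroup.mem_top a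
  exact ha

/-- **`(S^⊥)^⊥ = S` for a primitive `S` with `B|_S` and `B|_{S^⊥}` nondegenerate** (no unimodularity: both
`rk S + rk S^⊥` and `rk S^⊥ + rk S^⊥⊥` equal `rk L`, and a primitive sublattice is determined by its rank among
over-modules) — so that `H = L/(S ⊕ S^⊥)` and `p_{S^⊥}(H) ⊂ D(S^⊥)` refer to the same `S ⊕ S^⊥ = S^⊥ ⊕ S^⊥⊥`.
[cite: GritsenkoHulekSankaran2010Symplectic, §4 before Lemma 4.1 ("the lattices `S` and `S^⊥` are primitive in `L`")] [cite: Nikulin1980, §1.5] -/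
theorem orthogonal_orthogonal_eq_of_forall_smul_mem_of_nondegenerate (hB : B.IsSymm) (S : Submodule ℤ M)
    (hS : ∀ (k : ℤ) (x : M), k ≠ 0 → k • x ∈ S → x ∈ S) (hSnd : (B.restrict S).Nondegenerate)
    (hTnd : (B.restrict (B.orthogonal S)).Nondegenerate) : B.orthogonal (B.orthogonal S) = S := by
  have h1 := B.finrank_add_finrank_orthogonal_of_nondegenerate S hB hSnd
  have h2 := B.finrank_add_finrank_orthogonal_of_nondegenerate (B.orthogonal S) hB hTnd
  exact (eq_of_le_of_finrank_le_of_forall_smul_mem (hL := hS) (B.le_orthogonal_orthogonal hB.isRefl)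
    (by omega)).symm

/-- **`|p_{S^⊥}(H)| = |H| = [L : S ⊕ S^⊥]`** for a primitive `S` with `B|_S`, `B|_{S^⊥}` nondegenerate ("the injectivity
of `p_{S^⊥}` on `H`"). [cite: GritsenkoHulekSankaran2010Symplectic, §4 before Lemma 4.1 and proof of Cor. 4.4] [cite: GritsenkoHulekSankaran2013ModuliK3, §7 proof of Lemma 7.2] -/
theorem natCard_range_toDiscriminantGroup_orthogonal_eq_index (hB : B.IsSymm) (S : Submodule ℤ M)
    (hS : ∀ (k : ℤ) (x : M), k ≠ 0 → k • x ∈ S → x ∈ S) (hSnd : (B.restrict S).Nondegenerate)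
    (hTnd : (B.restrict (B.orthogonal S)).Nondegenerate) :
    Nat.card (LinearMap.range (B.toDiscriminantGroup (B.orthogonal S))) = (S ⊔ B.orthogonal S).toAddSubgroup.index := by
  rw [B.natCard_range_toDiscriminantGroup_eq_index _ hB,
    B.orthogonal_orthogonal_eq_of_forall_smul_mem_of_nondegenerate hB S hS hSnd hTnd, sup_comm]

end Projection

/-! ### §2 Lemma 4.2 (iii) and Cor. 4.4: `p_{S^⊥}(H) = D(S^⊥) ⟹ O(L, S)|_{S^⊥} = Õ(S^⊥)` -/

section Surjective

variable {M : Type*} [AddCommGroup M] (B : BilinForm ℤ M) (S : Submodule ℤ M) [Module.Finite ℤ M] [Module.Free ℤ M]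

/-- **Lemma 4.2 (iii), pointwise-trivial form: if `p_{S^⊥}(H) = D(S^⊥)` then
`{G|_{S^⊥} | G ∈ O(L), G|_S = id} = Õ(S^⊥)`** (`B|_{S^⊥}` nondegenerate): "⊆" because `ḡ` fixes `p_{S^⊥}(H)`, which is
everything; "⊇" by extension with the identity on `S` (Lemma 4.2 (ii)).
[cite: GritsenkoHulekSankaran2010Symplectic, §4 Lemma 4.2 (iii)] [cite: GritsenkoHulekSankaran2013ModuliK3, §7 Lemma 7.3 (iii)] -/
theorem setOf_exists_forall_apply_eq_eq_setOf_discriminantGroupCongr_eq_id_of_range_eq_top (hB : B.IsSymm)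
    (hT : (B.restrict (B.orthogonal S)).Nondegenerate)
    (hsurj : LinearMap.range (B.toDiscriminantGroup (B.orthogonal S)) = ⊤) :
    {g : (B.restrict (B.orthogonal S)).IsometryEquiv (B.restrict (B.orthogonal S)) |
        ∃ G : B.IsometryEquiv B, (∀ s ∈ S, G s = s) ∧ ∀ n : B.orthogonal S, G n = g n} =
      {g | ∀ a, g.discriminantGroupCongr a = a} := by
  ext g
  simp only [Set.mem_setOf_eq]
  rw [B.exists_isometryEquiv_eq_id_extends_iff hB S hT g]
  refine ⟨fun h a ↦ ?_, fun h x ↦ h _⟩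
  obtain ⟨x, hx⟩ : a ∈ LinearMap.range (B.toDiscriminantGroup (B.orthogonal S)) := by
    rw [hsurj]
    exact Submodule.mem_top
  rw [← hx]
  exact h x

/-- **Lemma 4.2 (iii) as printed, `O(L, S)|_{S^⊥} = Õ(S^⊥)` with `O(L,S) = {G ∈ O(L) | G|_S ∈ Õ(S)}`**: if
`p_{S^⊥}(H) = D(S^⊥)` (`B|_{S^⊥}` nondegenerate), the restrictions to `S^⊥` of the isometries `G` of `L` preserving `S`
with `G|_S = β ∈ Õ(S)` are exactly the isometries of `S^⊥` trivial on `D(S^⊥)`.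
[cite: GritsenkoHulekSankaran2010Symplectic, §4 Lemma 4.2 (iii)] [cite: GritsenkoHulekSankaran2013ModuliK3, §7 Lemma 7.3 (iii)] -/
theorem setOf_exists_restrict_stable_eq_setOf_discriminantGroupCongr_eq_id_of_range_eq_top (hB : B.IsSymm)
    (hT : (B.restrict (B.orthogonal S)).Nondegenerate)
    (hsurj : LinearMap.range (B.toDiscriminantGroup (B.orthogonal S)) = ⊤) :
    {g : (B.restrict (B.orthogonal S)).IsometryEquiv (B.restrict (B.orthogonal S)) |
        ∃ (G : B.IsometryEquiv B) (β : (B.restrict S).IsometryEquiv (B.restrict S)),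
          (∀ s : S, (β s : M) = G s) ∧ (∀ a, β.discriminantGroupCongr a = a) ∧
            ∀ n : B.orthogonal S, (g n : M) = G n} =
      {g | ∀ a, g.discriminantGroupCongr a = a} := by
  ext g
  simp only [Set.mem_setOf_eq]
  constructor
  · rintro ⟨G, β, hβ, hβbar, hg⟩ a
    obtain ⟨x, hx⟩ : a ∈ LinearMap.range (B.toDiscriminantGroup (B.orthogonal S)) := by
      rw [hsurj]
      exact Submodule.mem_top
    rw [← hx]
    exact B.discriminantGroupCongr_toDiscriminantGroup_eq_of_restrict_stable S hB G β hβ hβbar g hg x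
  · intro hg
    have hmem : g ∈ {g : (B.restrict (B.orthogonal S)).IsometryEquiv (B.restrict (B.orthogonal S)) |
        ∃ G : B.IsometryEquiv B, (∀ s ∈ S, G s = s) ∧ ∀ n : B.orthogonal S, G n = g n} := by
      rw [B.setOf_exists_forall_apply_eq_eq_setOf_discriminantGroupCongr_eq_id_of_range_eq_top S hB hT hsurj]
      exact hg
    obtain ⟨G, hGS, hGT⟩ := hmem
    exact ⟨G, IsometryEquiv.refl _, fun s ↦ (hGS s s.2).symm,
      fun a ↦ by rw [IsometryEquiv.discriminantGroupCongr_refl, LinearEquiv.refl_apply], fun n ↦ (hGT n).symm⟩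

/-- **Cor. 4.4: `|H| = |det S^⊥| ⟹ O(L, S)|_{S^⊥} = Õ(S^⊥)`**, for a primitive `S` with `B|_S`, `B|_{S^⊥}` nondegenerate,
`|H| = [L : S ⊕ S^⊥]` and `|det S^⊥| = |D(S^⊥)|`: the restrictions of the isometries trivial on `S` are exactly `Õ(S^⊥)`.
[cite: GritsenkoHulekSankaran2010Symplectic, §4 Cor. 4.4] [cite: GritsenkoHulekSankaran2013ModuliK3, §7 Cor. 7.4] -/
theorem setOf_exists_forall_apply_eq_eq_setOf_discriminantGroupCongr_eq_id_of_index_eq_natCard (hB : B.IsSymm)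
    (hS : ∀ (k : ℤ) (x : M), k ≠ 0 → k • x ∈ S → x ∈ S) (hSnd : (B.restrict S).Nondegenerate)
    (hT : (B.restrict (B.orthogonal S)).Nondegenerate)
    (h : (S ⊔ B.orthogonal S).toAddSubgroup.index = Nat.card (B.restrict (B.orthogonal S)).discriminantGroup) :
    {g : (B.restrict (B.orthogonal S)).IsometryEquiv (B.restrict (B.orthogonal S)) |
        ∃ G : B.IsometryEquiv B, (∀ s ∈ S, G s = s) ∧ ∀ n : B.orthogonal S, G n = g n} =
      {g | ∀ a, g.discriminantGroupCongr a = a} := by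
  refine B.setOf_exists_forall_apply_eq_eq_setOf_discriminantGroupCongr_eq_id_of_range_eq_top S hB hT
    (B.range_toDiscriminantGroup_eq_top_of_index_eq_natCard _ hB hT ?_)
  rw [B.orthogonal_orthogonal_eq_of_forall_smul_mem_of_nondegenerate hB S hS hSnd hT, sup_comm, h]

/-- **Cor. 4.4 with `O(L,S) = {G | G|_S ∈ Õ(S)}`**: under `|H| = |det S^⊥|` the restrictions to `S^⊥` of the isometries
of `L` that are stable on `S` are exactly `Õ(S^⊥)`. [cite: GritsenkoHulekSankaran2010Symplectic, §4 Cor. 4.4] [cite: GritsenkoHulekSankaran2013ModuliK3, §7 Cor. 7.4] -/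
theorem setOf_exists_restrict_stable_eq_setOf_discriminantGroupCongr_eq_id_of_index_eq_natCard (hB : B.IsSymm)
    (hS : ∀ (k : ℤ) (x : M), k ≠ 0 → k • x ∈ S → x ∈ S) (hSnd : (B.restrict S).Nondegenerate)
    (hT : (B.restrict (B.orthogonal S)).Nondegenerate)
    (h : (S ⊔ B.orthogonal S).toAddSubgroup.index = Nat.card (B.restrict (B.orthogonal S)).discriminantGroup) :
    {g : (B.restrict (B.orthogonal S)).IsometryEquiv (B.restrict (B.orthogonal S)) |
        ∃ (G : B.IsometryEquiv B) (β : (B.restrict S).IsometryEquiv (B.restrict S)),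
          (∀ s : S, (β s : M) = G s) ∧ (∀ a, β.discriminantGroupCongr a = a) ∧
            ∀ n : B.orthogonal S, (g n : M) = G n} =
      {g | ∀ a, g.discriminantGroupCongr a = a} := by
  refine B.setOf_exists_restrict_stable_eq_setOf_discriminantGroupCongr_eq_id_of_range_eq_top S hB hT
    (B.range_toDiscriminantGroup_eq_top_of_index_eq_natCard _ hB hT ?_)
  rw [B.orthogonal_orthogonal_eq_of_forall_smul_mem_of_nondegenerate hB S hS hSnd hT, sup_comm, h]

omit [Module.Free ℤ M] in
/-- **`p_{S^⊥}(H) = D(S^⊥)` for unimodular `L`** and any `S` ("the condition of the corollary is true if `L` is an even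
unimodular lattice and `S` is any primitive sublattice": `(x, ·)|_{S^⊥}` runs through all of `(S^⊥)^*` since `S^⊥` is
primitive and `L^* = L`; neither evenness nor primitivity of `S` is needed).
[cite: GritsenkoHulekSankaran2010Symplectic, §4 Cor. 4.4] [cite: Huybrechts2016K3, Ch. 14 §0.2 ("surjective if … `Λ` is unimodular")] -/
theorem range_toDiscriminantGroup_orthogonal_eq_top_of_isPerfPair [B.IsPerfPair] (hB : B.IsSymm) :
    LinearMap.range (B.toDiscriminantGroup (B.orthogonal S)) = ⊤ := by
  refine eq_top_iff.2 fun a _ ↦ ?_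
  obtain ⟨x, hx⟩ := B.exists_mk_domRestrict₂_eq (B.orthogonal S) hB
    (fun k x hk hx ↦ B.mem_orthogonal_of_smul_mem S hk hx) a
  exact ⟨x, hx⟩

/-- **Huybrechts' Cor. 14.2.7 for every sublattice `S` ∕ the unimodular case of Cor. 4.4:
`{g ∈ O(S^⊥) | ḡ = id} = {g|_{S^⊥} | g ∈ O(Λ), g|_S = id}`** for `Λ` unimodular, `B` symmetric and any `S` with `B|_S`
nondegenerate (the tree's `setOf_discriminantGroupCongr_eq_id_eq` is the case `S = ℤℓ`; the K3 reading is
"`O(L_{K3}, h) ≅ Õ(h^⊥)`" of Handbook Example 7.6 and, for `S = NS(X)`, the action of `O(H²(X,ℤ), NS)` on `T_X`).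
[cite: Huybrechts2016K3, Ch. 14 Cor. 2.7] [cite: GritsenkoHulekSankaran2010Symplectic, §4 Cor. 4.4] [cite: GritsenkoHulekSankaran2013ModuliK3, §7 Cor. 7.4 and Example 7.6] -/
theorem setOf_discriminantGroupCongr_eq_id_eq_setOf_exists_forall_apply_eq_of_isPerfPair [B.IsPerfPair]
    (hB : B.IsSymm) (hSnd : (B.restrict S).Nondegenerate) :
    {g : (B.restrict (B.orthogonal S)).IsometryEquiv (B.restrict (B.orthogonal S)) |
        ∀ a, g.discriminantGroupCongr a = a} =
      {g | ∃ G : B.IsometryEquiv B, (∀ s ∈ S, G s = s) ∧ ∀ n : B.orthogonal S, G n = g n} :=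
  (B.setOf_exists_forall_apply_eq_eq_setOf_discriminantGroupCongr_eq_id_of_range_eq_top S hB
    (B.nondegenerate_restrict_orthogonal_of_nondegenerate_restrict (B.nondegenerate_of_isPerfPair_of_isSymm hB) hB
      S hSnd)
    (B.range_toDiscriminantGroup_orthogonal_eq_top_of_isPerfPair S hB)).symm

end Surjective

/-! ### §3 Lemma 4.2 (iv): `O(L, S)|_{S^⊥}/Õ(S^⊥) ≅ {γ̄ ∈ O(D(S^⊥)) | γ̄|_{p_{S^⊥}(H)} = id}` as a count -/

section Quotient

variable {M : Type*} [AddCommGroup M] (B : BilinForm ℤ M) (T : Submodule ℤ M) [Module.Finite ℤ M] [Module.Free ℤ M]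

/-- **Lemma 4.2 (iv).** "Assume that the projection `O(S^⊥) → O(D(S^⊥))` is surjective. Then
`O(L,S)|_{S^⊥}/Õ(S^⊥) ≅ {γ̄ ∈ O(D(S^⊥)) | γ̄|_{p_{S^⊥}(H)} = id}`": for `T` (= `S^⊥`) even nondegenerate, if every
isometry of the discriminant form `q_T` is some `γ̄`, then the classes of `{γ ∈ O(T) | γ̄|_{p_T(H)} = id}` — by
Lemma 4.2 (ii) (`exists_isometryEquiv_eq_id_extends_iff`) this set is `O(L,S)|_{S^⊥}` — under "`γ̄ = γ̄'`" (the cosets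
of `Õ(T)`, `discriminantGroupCongr_eq_iff`) correspond bijectively to `{σ ∈ O(q_T) | σ|_{p_T(H)} = id}`.
[cite: GritsenkoHulekSankaran2010Symplectic, §4 Lemma 4.2 (iv)] [cite: GritsenkoHulekSankaran2013ModuliK3, §7 Lemma 7.3 (iv)] -/
theorem natCard_quot_setOf_discriminantGroupCongr_toDiscriminantGroup_eq (hT : (B.restrict T).Nondegenerate)
    (hsT : (B.restrict T).IsSymm) (heT : (B.restrict T).IsEven)
    (hsurj : ∀ σ : (B.restrict T).discriminantGroup ≃ₗ[ℤ] (B.restrict T).discriminantGroup,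
      (∀ a, (B.restrict T).discriminantQuad hT hsT heT (σ a) = (B.restrict T).discriminantQuad hT hsT heT a) →
        ∃ γ : (B.restrict T).IsometryEquiv (B.restrict T), γ.discriminantGroupCongr = σ) :
    Nat.card (Quot fun γ γ' : {γ : (B.restrict T).IsometryEquiv (B.restrict T) //
        ∀ x : M, γ.discriminantGroupCongr (B.toDiscriminantGroup T x) = B.toDiscriminantGroup T x} ↦
          γ.1.discriminantGroupCongr = γ'.1.discriminantGroupCongr) =
      Nat.card {σ : (B.restrict T).discriminantGroup ≃ₗ[ℤ] (B.restrict T).discriminantGroup //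
        (∀ a, (B.restrict T).discriminantQuad hT hsT heT (σ a) = (B.restrict T).discriminantQuad hT hsT heT a) ∧
          ∀ x : M, σ (B.toDiscriminantGroup T x) = B.toDiscriminantGroup T x} := by
  refine Nat.card_eq_of_bijective
    (Quot.lift (fun γ ↦ (⟨γ.1.discriminantGroupCongr,
        fun a ↦ γ.1.discriminantQuad_discriminantGroupCongr hT hsT heT hT hsT heT a, γ.2⟩ :
        {σ : (B.restrict T).discriminantGroup ≃ₗ[ℤ] (B.restrict T).discriminantGroup //
          (∀ a, (B.restrict T).discriminantQuad hT hsT heT (σ a) = (B.restrict T).discriminantQuad hT hsT heT a) ∧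
            ∀ x : M, σ (B.toDiscriminantGroup T x) = B.toDiscriminantGroup T x}))
      (fun γ γ' h ↦ Subtype.ext h)) ⟨?_, ?_⟩
  · rintro ⟨γ⟩ ⟨γ'⟩ h
    exact Quot.sound (Subtype.ext_iff.1 h)
  · rintro ⟨σ, hσq, hσp⟩
    obtain ⟨γ, hγ⟩ := hsurj σ hσq
    exact ⟨Quot.mk _ ⟨γ, fun x ↦ by rw [hγ]; exact hσp x⟩, Subtype.ext hγ⟩

end Quotient

end LinearMap.BilinForm
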